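import Literature.Computability.Complexity.StackBricks
import Literature.Computability.Complexity.StackDiv
import Literature.Computability.Complexity.StackMul
import HarnessLib

/-!
# Arithmetic bricks: gcd, product, remainder, quotient and modular power as `FP` string functions

Trunk `CplxCore`, continuing `StackBricks.lean` (the packaging `Brick.binOp_mem_FP` of a
verified stack routine as a total `FP` function on `boolPair`-coded operands). The routines of
`StackGcd.lean` (`Com.gcdXY`, Euclid; `Com.remOf`, restoring division), `StackDiv.lean`
(`Com.divOf`, quotient), `StackMul.lean` (`Com.mulOf`, Horner multiplication) and
`StackModArith.lean` (`Com.modExp`, square-and-multiply, cost `modExpStepCost`) are stated for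
normal operands / a positive divisor / a modulus `≥ 2` and use outer registers; here each is
wrapped with the normalisations and the guards that make it total, and packaged:

* `gcdFn ⟨a, b⟩ = encodeNat (gcd ⟦a⟧ ⟦b⟧)`, `prodFn ⟨a, b⟩ = encodeNat (⟦a⟧ · ⟦b⟧)` (named apart
  from the unary `Literature.Computability.Complexity.mulFn` of `UnaryArithMachines.lean`),
  `remFn ⟨a, b⟩ = encodeNat (⟦a⟧ mod ⟦b⟧)`, `divFn ⟨a, b⟩ = encodeNat (⟦a⟧ / ⟦b⟧)` (with Lean's
  conventions `k mod 0 = k`, `k / 0 = 0`), each in `FP` (`gcdFn_mem_FP`, …), with the `_boolPair`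
  evaluation lemmas used by the `FP`-algebra (`fanoutFn`, `iteFn`, `comp_mem_FP`);
* `modExpFn ⟨a, ⟨e, m⟩⟩ = encodeNat (⟦a⟧ ^ ⟦e⟧ mod ⟦m⟧)` for `⟦m⟧ ≥ 2`, and `[]` (zero) for
  `⟦m⟧ ≤ 1` (`modExpFn_mem_FP`; three operands via a nested pair) — NOTE the different zero
  convention: `remFn` returns the dividend at divisor `0` (Lean's `k % 0 = k`), whereas `modExpFn`
  returns `0` at modulus `0` (the true value `k % 1 = 0` at modulus `1`; at modulus `0` Lean's
  value `a ^ e` would be exponentially long).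

Numerals are read by `bitsToNat` (least significant bit first, total) and written canonically
(`encodeNat`).

## References

* T. H. Cormen, C. E. Leiserson, R. L. Rivest, C. Stein, *Introduction to Algorithms*, 3rd ed.,
  MIT Press 2009, §31.2 (Euclid's algorithm), §31.1 (division theorem).
* D. E. Knuth, *The Art of Computer Programming*, Vol. 2, 3rd ed., 1998, §4.3.1 (Algorithms M, D).
* S. Arora, B. Barak, *Computational Complexity: A Modern Approach*, CUP 2009, §1.3.
-/

namespace Literature.Computability.Complexity

open _root_.Computability AReg

namespace Brick

/-- Outer registers of the arithmetic bricks (multiplier / dividend bits, quotient, two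
scratch). [folklore] -/
inductive O
  | om | oq | od | ofl
  deriving DecidableEq, Fintype, Repr

/-- The two-operand start file with outer registers: outer part empty, bank `file a b [] … []`.
[folklore] -/
theorem init2_obank (a b : List Bool) :
    init2 (Sum.inr AReg.x : O ⊕ AReg) (Sum.inr AReg.y) a b = Sum.elim (fun _ => []) (file a b [] [] [] [] [] []) := by
  funext i; rcases i with i | i
  · cases i <;> rfl
  · cases i <;> rfl

/-! ### Normalising both operands -/

/-- `normXY`: normalise `x` and `y` (through `swapXY`). [folklore] -/
def normXY : Com AReg := Com.normalize ;; (Com.swapXY ;; (Com.normalize ;; Com.swapXY))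

/-- **Effect of `normXY`**: `x := norm x`, `y := norm y`, in `21(|x| + |y|) + 18` steps. [folklore] -/
theorem runs_normXY (a b : List Bool) :
    Com.Runs normXY (file a b [] [] [] [] [] []) (file (norm a) (norm b) [] [] [] [] [] []) (21 * (a.length + b.length) + 18) := by
  have ha := length_norm_le a
  have hb := length_norm_le b
  have h1 := Com.runs_normalize a b [] [] [] []
  have h2 := Com.runs_swapXY (norm a) b [] [] [] []
  have h3 := Com.runs_normalize b (norm a) [] [] [] []
  have h4 := Com.runs_swapXY (norm b) (norm a) [] [] [] []
  exact (h1.seq (h2.seq (h3.seq h4))).mono (by omega)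

/-! ### Greatest common divisor -/

/-- The gcd brick's routine: normalise, then Euclid (`gcdXY`). [cite: CLRS2009, §31.2 (EUCLID)] -/
def gcdC : Com (O ⊕ AReg) := Com.bk normXY ;; Com.gcdXY O.ofl O.om O.od

/-- `gcdFn ⟨a, b⟩ = encodeNat (gcd ⟦a⟧ ⟦b⟧)`. [folklore] -/
def gcdFn (w : List Bool) : List Bool :=
  encodeNat (Nat.gcd (bitsToNat (boolUnpair w).1) (bitsToNat (boolUnpair w).2))

/-- `gcdFn` on a pair. [folklore] -/
@[simp] theorem gcdFn_boolPair (a b : List Bool) :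
    gcdFn (boolPair a b) = encodeNat (Nat.gcd (bitsToNat a) (bitsToNat b)) := by
  simp [gcdFn]

/-- `euclidCost` is monotone. [folklore] -/
theorem euclidCost_mono {L L' : ℕ} (h : L ≤ L') : Com.euclidCost L ≤ Com.euclidCost L' := by
  unfold Com.euclidCost
  have := Nat.mul_le_mul h (show 41 * L + 48 ≤ 41 * L' + 48 by omega)
  omega

/-- `gcd m n ≤ m + n`. [folklore] -/
theorem gcd_le_add (m n : ℕ) : Nat.gcd m n ≤ m + n := by
  rcases Nat.eq_zero_or_pos m with rfl | hm
  · simp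
  · exact (Nat.gcd_le_left n hm).trans (Nat.le_add_right m n)

/-- Sizes are subadditive in the value: `|encodeNat (m + n)| ≤ |encodeNat m| + |encodeNat n| + 1`
is not needed; we use the cruder `|encodeNat k| ≤ |a| + |b| + 1` for `k ≤ ⟦a⟧ + ⟦b⟧`. [folklore] -/
theorem length_encodeNat_le_of_le_add {k : ℕ} {a b : List Bool} (h : k ≤ bitsToNat a + bitsToNat b) :
    (encodeNat k).length ≤ a.length + b.length + 1 := by
  rw [TM2Pass.length_encodeNat_eq_size, Nat.size_le]
  have ha := bitsToNat_lt a
  have hb := bitsToNat_lt b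
  calc k ≤ bitsToNat a + bitsToNat b := h
    _ < 2 ^ a.length + 2 ^ b.length := by omega
    _ ≤ 2 ^ (a.length + b.length) + 2 ^ (a.length + b.length) :=
        Nat.add_le_add (Nat.pow_le_pow_right (by norm_num) (by omega)) (Nat.pow_le_pow_right (by norm_num) (by omega))
    _ = 2 ^ (a.length + b.length + 1) := by rw [pow_succ]; ring

/-- Cost of the gcd brick in the total operand length. [folklore] -/
def gcdCost (n : ℕ) : ℕ := 21 * n + 18 + ((2 * n + 1) * (Com.euclidCost n + 2) + 20 * n + 8)

/-- **`gcdFn ∈ FP`.** [cite: CLRS2009, §31.2 (Thm. 31.11: Euclid's algorithm is polynomial)] -/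
theorem gcdFn_mem_FP : gcdFn ∈ FP := by
  refine binOp_mem_FP gcdC (show (Sum.inr AReg.x : O ⊕ AReg) ≠ Sum.inr AReg.y by decide) (Sum.inr AReg.x)
    (fun a b => encodeNat (Nat.gcd (bitsToNat a) (bitsToNat b))) gcdCost
    (41 * Polynomial.X + 26 + (2 * Polynomial.X + 1) * (Polynomial.X * (41 * Polynomial.X + 48) + 15 * Polynomial.X + 14))
    (fun n => le_of_eq ?_) (fun a b => ?_) (fun a b => ?_)
  · simp [gcdCost, Com.euclidCost]; ring
  · refine (length_encodeNat_le_of_le_add (gcd_le_add (bitsToNat a) (bitsToNat b))).trans ?_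
    simp
    nlinarith [Nat.zero_le ((2 * (a.length + b.length) + 1) *
      ((a.length + b.length) * (41 * (a.length + b.length) + 48) + 15 * (a.length + b.length) + 14))]
  · rw [init2_obank]
    have h1 : Com.Runs (Com.bk normXY : Com (O ⊕ AReg)) (Sum.elim (fun _ => []) (file a b [] [] [] [] [] []))
        (Sum.elim (fun _ => []) (file (norm a) (norm b) [] [] [] [] [] [])) (21 * (a.length + b.length) + 18) :=
      (runs_normXY a b).inr _
    have h2 := Com.runs_gcdXY (κ := O) (fuel := O.ofl) (m := O.om) (d := O.od) (by decide) (by decide) (by decide)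
      (fun _ => []) rfl rfl rfl (norm a) (norm b) [] (Com.norm_norm a) (Com.norm_norm b)
    rw [bitsToNat_norm, bitsToNat_norm] at h2
    have hna := length_norm_le a
    have hnb := length_norm_le b
    have hE := euclidCost_mono (show (norm a).length + (norm b).length ≤ a.length + b.length by omega)
    have hmul : (2 * (norm b).length + 1) * (Com.euclidCost ((norm a).length + (norm b).length) + 2) ≤
        (2 * (a.length + b.length) + 1) * (Com.euclidCost (a.length + b.length) + 2) :=
      Nat.mul_le_mul (by omega) (by omega)
    refine ⟨_, (h1.seq h2).mono ?_, by simp⟩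
    unfold gcdCost; omega

/-! ### Product -/

/-- The product brick's routine: lay the multiplier on the outer register (most significant bit
first), Horner multiplication (`mulOf`), normalise. [cite: CLRS2009, §31.1 (schoolbook arithmetic is polynomial)] -/
def mulC : Com (O ⊕ AReg) := Com.pour (Sum.inr .x) (Sum.inl O.om) ;; (Com.mulOf O.om ;; Com.bk Com.normalize)

/-- `prodFn ⟨a, b⟩ = encodeNat (⟦a⟧ · ⟦b⟧)`. [folklore] -/
def prodFn (w : List Bool) : List Bool :=
  encodeNat (bitsToNat (boolUnpair w).1 * bitsToNat (boolUnpair w).2)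

/-- `prodFn` on a pair. [folklore] -/
@[simp] theorem prodFn_boolPair (a b : List Bool) : prodFn (boolPair a b) = encodeNat (bitsToNat a * bitsToNat b) := by
  simp [prodFn]

/-- `|encodeNat (⟦a⟧ ⟦b⟧)| ≤ |a| + |b|`. [folklore] -/
theorem length_encodeNat_mul_le (a b : List Bool) :
    (encodeNat (bitsToNat a * bitsToNat b)).length ≤ a.length + b.length := by
  rw [TM2Pass.length_encodeNat_eq_size, Nat.size_le, pow_add]
  exact Nat.mul_lt_mul'' (bitsToNat_lt a) (bitsToNat_lt b)

/-- Cost of the product brick in the total operand length. [folklore] -/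
def mulCost (n : ℕ) : ℕ := 3 * n + 1 + (n * (44 * (n + n) + 52) + 1 + (9 * (n + n) + 5))

/-- **`prodFn ∈ FP`.** [cite: CLRS2009, §31.1 (schoolbook arithmetic is polynomial)] -/
theorem prodFn_mem_FP : prodFn ∈ FP := by
  refine binOp_mem_FP mulC (show (Sum.inr AReg.x : O ⊕ AReg) ≠ Sum.inr AReg.y by decide) (Sum.inr AReg.x)
    (fun a b => encodeNat (bitsToNat a * bitsToNat b)) mulCost
    (21 * Polynomial.X + 7 + Polynomial.X * (88 * Polynomial.X + 52))
    (fun n => le_of_eq ?_) (fun a b => ?_) (fun a b => ?_)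
  · simp [mulCost]; ring
  · refine (length_encodeNat_mul_le a b).trans ?_
    simp
    nlinarith [Nat.zero_le ((a.length + b.length) * (88 * (a.length + b.length) + 52))]
  · rw [init2_obank]
    -- lay the multiplier
    have h1 : Com.Runs (Com.pour (Sum.inr .x) (Sum.inl O.om) : Com (O ⊕ AReg)) (Sum.elim (fun _ => []) (file a b [] [] [] [] [] []))
        (Sum.elim (Function.update (fun _ => []) O.om a.reverse) (file [] b [] [] [] [] [] [])) (3 * a.length + 1) :=
      (Com.runs_pour (a := (Sum.inr AReg.x : O ⊕ AReg)) (b := Sum.inl O.om) (by simp) _).of_eq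
        (by simp [-Sum.elim_update_left, -Sum.elim_update_right]) (by simp)
    -- Horner
    have h2 := Com.runs_mulOf (κ := O) O.om a.reverse (Function.update (fun _ => []) O.om a.reverse) [] b [] [] [] b.length
      (by simp) (by simpa using bitsToNat_lt b) (by simp) le_rfl
    rw [Function.update_idem, Function.update_eq_self_iff.2 rfl] at h2
    -- normalise
    have h3 : Com.Runs (Com.bk Com.normalize : Com (O ⊕ AReg))
        (Sum.elim (fun _ => []) (file (Com.mulOfRes a.reverse [] b) b [] [] [] [] [] []))
        (Sum.elim (fun _ => []) (file (norm (Com.mulOfRes a.reverse [] b)) b [] [] [] [] [] [])) (9 * (a.length + b.length) + 5) := by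
      refine ((Com.runs_normalize (Com.mulOfRes a.reverse [] b) b [] [] [] []).inr _).mono ?_
      have hl : (Com.mulOfRes a.reverse [] b).length ≤ a.length + b.length := by
        rw [← Com.norm_mulOfRes a.reverse [] b rfl, norm_eq_encodeNat, Com.bitsToNat_mulOfRes_nil, List.reverse_reverse,
          Nat.mul_comm]
        exact length_encodeNat_mul_le a b
      omega
    refine ⟨_, (h1.seq (h2.seq h3)).mono ?_, ?_⟩
    · simp only [List.length_reverse, mulCost]
      have : a.length * (44 * (b.length + a.length) + 52) ≤ (a.length + b.length) * (44 * ((a.length + b.length) + (a.length + b.length)) + 52) :=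
        Nat.mul_le_mul (by omega) (by omega)
      omega
    · simp [norm_eq_encodeNat, Com.bitsToNat_mulOfRes_nil, Nat.mul_comm]

/-! ### Remainder and quotient -/

/-- Common prelude of the division bricks: dividend bits to the outer register `om` (most
significant bit first), divisor normalised on `y`, `x` emptied:
from `file a b` to `om = aʳ`, `x = []`, `y = norm b`. [folklore] -/
def divPrep : Com (O ⊕ AReg) :=
  Com.pour (Sum.inr .x) (Sum.inl O.om) ;; Com.bk (Com.swapXY ;; (Com.normalize ;; Com.swapXY))

/-- **Effect of `divPrep`**, in `24(|a| + |b|) + 14` steps. [folklore] -/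
theorem runs_divPrep (a b : List Bool) :
    Com.Runs divPrep (Sum.elim (fun _ => []) (file a b [] [] [] [] [] []))
      (Sum.elim (Function.update (fun _ => []) O.om a.reverse) (file [] (norm b) [] [] [] [] [] []))
      (24 * (a.length + b.length) + 14) := by
  have h1 : Com.Runs (Com.pour (Sum.inr .x) (Sum.inl O.om) : Com (O ⊕ AReg)) (Sum.elim (fun _ => []) (file a b [] [] [] [] [] []))
      (Sum.elim (Function.update (fun _ => []) O.om a.reverse) (file [] b [] [] [] [] [] [])) (3 * a.length + 1) :=
    (Com.runs_pour (a := (Sum.inr AReg.x : O ⊕ AReg)) (b := Sum.inl O.om) (by simp) _).of_eq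
      (by simp [-Sum.elim_update_left, -Sum.elim_update_right]) (by simp)
  have hb := length_norm_le b
  have h2 := Com.runs_swapXY [] b [] [] [] []
  have h3 := Com.runs_normalize b [] [] [] [] []
  have h4 := Com.runs_swapXY (norm b) [] [] [] [] []
  have h234 : Com.Runs (Com.bk (Com.swapXY ;; (Com.normalize ;; Com.swapXY)) : Com (O ⊕ AReg))
      (Sum.elim (Function.update (fun _ => []) O.om a.reverse) (file [] b [] [] [] [] [] []))
      (Sum.elim (Function.update (fun _ => []) O.om a.reverse) (file [] (norm b) [] [] [] [] [] [])) (21 * b.length + 13) :=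
    ((h2.seq (h3.seq h4)).inr _).mono (by simp; omega)
  exact (h1.seq h234).mono (by omega)

/-- The remainder brick's routine: `divPrep`; if the divisor is zero the answer is the dividend
(`k mod 0 = k`), otherwise restoring division (`remOf`) and normalisation. [cite: CLRS2009, §31.1 (division theorem)] -/
def remC : Com (O ⊕ AReg) :=
  divPrep ;;
  Com.pop (Sum.inr .y)
    (Com.push (Sum.inr .y) true ;; (Com.remOf O.om ;; Com.bk Com.normalize))
    (Com.push (Sum.inr .y) false ;; (Com.remOf O.om ;; Com.bk Com.normalize))
    (Com.pour (Sum.inl O.om) (Sum.inr .x) ;; Com.bk Com.normalize)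

/-- `remFn ⟨a, b⟩ = encodeNat (⟦a⟧ mod ⟦b⟧)` (`mod 0` is the identity). [folklore] -/
def remFn (w : List Bool) : List Bool :=
  encodeNat (bitsToNat (boolUnpair w).1 % bitsToNat (boolUnpair w).2)

/-- `remFn` on a pair. [folklore] -/
@[simp] theorem remFn_boolPair (a b : List Bool) : remFn (boolPair a b) = encodeNat (bitsToNat a % bitsToNat b) := by
  simp [remFn]

/-- Cost of the division bricks in the total operand length. [folklore] -/
def divCost (n : ℕ) : ℕ := 24 * n + 14 + (3 + (n * (41 * n + 48) + 1 + (14 * n + 10)))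

/-- The main branch of the remainder brick on a positive normal divisor. [folklore] -/
theorem runs_remMain (a nb : List Bool) (hpos : 0 < bitsToNat nb) :
    Com.Runs (Com.remOf O.om ;; Com.bk Com.normalize : Com (O ⊕ AReg))
      (Sum.elim (Function.update (fun _ => []) O.om a.reverse) (file [] nb [] [] [] [] [] []))
      (Sum.elim (fun _ => []) (file (encodeNat (bitsToNat a % bitsToNat nb)) nb [] [] [] [] [] []))
      (a.length * (41 * nb.length + 48) + 1 + (9 * nb.length + 5)) := by
  have h1 := Com.runs_remOf (κ := O) O.om a.reverse (Function.update (fun _ => []) O.om a.reverse) [] nb []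
    (by simp) (by simpa using hpos) (by simp)
  rw [Function.update_idem, Function.update_eq_self_iff.2 rfl, List.length_reverse] at h1
  obtain ⟨-, hl⟩ := Com.remOfRes_lt_and_length a.reverse [] nb (by simpa using hpos) (by simp)
  have h2 : Com.Runs (Com.bk Com.normalize : Com (O ⊕ AReg))
      (Sum.elim (fun _ => []) (file (Com.remOfRes a.reverse [] nb) nb [] [] [] [] [] []))
      (Sum.elim (fun _ => []) (file (encodeNat (bitsToNat a % bitsToNat nb)) nb [] [] [] [] [] [])) (9 * nb.length + 5) := by
    refine ((Com.runs_normalize (Com.remOfRes a.reverse [] nb) nb [] [] [] []).inr _).of_eq ?_ (by omega)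
    rw [norm_eq_encodeNat, Com.bitsToNat_remOfRes_nil a.reverse nb (by simpa using hpos), List.reverse_reverse]
  exact h1.seq h2

/-- **`remFn ∈ FP`.** [cite: CLRS2009, §31.1 (division with remainder is polynomial)] -/
theorem remFn_mem_FP : remFn ∈ FP := by
  refine binOp_mem_FP remC (show (Sum.inr AReg.x : O ⊕ AReg) ≠ Sum.inr AReg.y by decide) (Sum.inr AReg.x)
    (fun a b => encodeNat (bitsToNat a % bitsToNat b)) divCost
    (38 * Polynomial.X + 28 + Polynomial.X * (41 * Polynomial.X + 48))
    (fun n => le_of_eq ?_) (fun a b => ?_) (fun a b => ?_)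
  · simp [divCost]; ring
  · have h1 : (encodeNat (bitsToNat a % bitsToNat b)).length ≤ a.length := by
      refine (length_encodeNat_mono (Nat.mod_le _ _)).trans (length_encodeNat_bitsToNat_le a)
    refine h1.trans ?_
    simp; nlinarith [Nat.zero_le ((a.length + b.length) * (41 * (a.length + b.length) + 48))]
  · rw [init2_obank]
    have h0 := runs_divPrep a b
    have hnb := length_norm_le b
    set T1 : Regs O := Function.update (fun _ => []) O.om a.reverse with hT1
    rcases hn : norm b with _ | ⟨c, nb'⟩
    · -- divisor `0`: the answer is `⟦a⟧`
      rw [hn] at h0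
      have hb0 : bitsToNat b = 0 := by simpa [hn] using (bitsToNat_norm b).symm
      have h1 : Com.Runs (Com.pour (Sum.inl O.om) (Sum.inr .x) : Com (O ⊕ AReg)) (Sum.elim T1 (file [] [] [] [] [] [] [] []))
          (Sum.elim (fun _ => []) (file a [] [] [] [] [] [] [])) (3 * a.length + 1) :=
        (Com.runs_pour (a := (Sum.inl O.om : O ⊕ AReg)) (b := Sum.inr AReg.x) (by simp) _).of_eq
          (by simp [-Sum.elim_update_left, -Sum.elim_update_right, hT1, Function.update_idem])
          (by simp [hT1])
      have h2 : Com.Runs (Com.bk Com.normalize : Com (O ⊕ AReg)) (Sum.elim (fun _ => []) (file a [] [] [] [] [] [] []))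
          (Sum.elim (fun _ => []) (file (norm a) [] [] [] [] [] [] [])) (9 * a.length + 5) :=
        (Com.runs_normalize a [] [] [] [] []).inr _
      have h12 := Com.Runs.pop_nil (k := (Sum.inr AReg.y : O ⊕ AReg)) (R := Sum.elim T1 (file [] [] [] [] [] [] [] []))
        (Com.push (Sum.inr .y) true ;; (Com.remOf O.om ;; Com.bk Com.normalize))
        (Com.push (Sum.inr .y) false ;; (Com.remOf O.om ;; Com.bk Com.normalize)) rfl (h1.seq h2)
      refine ⟨_, (h0.seq h12).mono ?_, ?_⟩
      · unfold divCost; nlinarith [Nat.zero_le ((a.length + b.length) * (41 * (a.length + b.length) + 48))]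
      · simp [hb0, norm_eq_encodeNat]
    · -- positive divisor
      rw [hn] at h0
      have hpos : 0 < bitsToNat (c :: nb') := by
        have h := (norm_eq_nil_iff b).not
        rw [hn] at h
        have : ¬ bitsToNat b = 0 := by simpa using h
        rw [← bitsToNat_norm b, hn] at this
        omega
      have hmain := runs_remMain a (c :: nb') hpos
      have hval : bitsToNat (c :: nb') = bitsToNat b := by rw [← hn, bitsToNat_norm]
      have hpush : ∀ d : Bool, Com.Runs (Com.push (Sum.inr .y) d : Com (O ⊕ AReg)) (Sum.elim T1 (file [] nb' [] [] [] [] [] []))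
          (Sum.elim T1 (file [] (d :: nb') [] [] [] [] [] [])) 1 := fun d =>
        Com.Runs.push' (by simp [-Sum.elim_update_left, -Sum.elim_update_right])
      have hbr : Com.Runs
          (Com.pop (Sum.inr .y)
            (Com.push (Sum.inr .y) true ;; (Com.remOf O.om ;; Com.bk Com.normalize))
            (Com.push (Sum.inr .y) false ;; (Com.remOf O.om ;; Com.bk Com.normalize))
            (Com.pour (Sum.inl O.om) (Sum.inr .x) ;; Com.bk Com.normalize) : Com (O ⊕ AReg))
          (Sum.elim T1 (file [] (c :: nb') [] [] [] [] [] []))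
          (Sum.elim (fun _ => []) (file (encodeNat (bitsToNat a % bitsToNat (c :: nb'))) (c :: nb') [] [] [] [] [] []))
          (1 + (a.length * (41 * (c :: nb').length + 48) + 1 + (9 * (c :: nb').length + 5)) + 2) := by
        cases c
        · exact Com.Runs.pop_false (k := (Sum.inr AReg.y : O ⊕ AReg)) (R := Sum.elim T1 (file [] (false :: nb') [] [] [] [] [] []))
            _ _ (w := nb') rfl (by simpa [-Sum.elim_update_left, -Sum.elim_update_right] using (hpush false).seq hmain)
        · exact Com.Runs.pop_true (k := (Sum.inr AReg.y : O ⊕ AReg)) (R := Sum.elim T1 (file [] (true :: nb') [] [] [] [] [] []))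
            _ _ (w := nb') rfl (by simpa [-Sum.elim_update_left, -Sum.elim_update_right] using (hpush true).seq hmain)
      refine ⟨_, (h0.seq hbr).mono ?_, ?_⟩
      · have hl : (c :: nb').length ≤ b.length := by rw [← hn]; exact hnb
        unfold divCost
        have : a.length * (41 * (c :: nb').length + 48) ≤ (a.length + b.length) * (41 * (a.length + b.length) + 48) :=
          Nat.mul_le_mul (by omega) (by omega)
        omega
      · simp [hval]

/-- Length of the quotient register after `divOf` (file-local copy of
`Com.length_divBits`, which `StackWordArith.lean` declares; that file is not imported here).
[folklore] -/
private theorem length_divBits' : ∀ (bs acc n qs : List Bool),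
    (Com.divBits bs acc n qs).length = bs.length + qs.length
  | [], _, _, qs => by simp [Com.divBits]
  | b :: bs, acc, n, qs => by
    rw [Com.divBits, length_divBits' bs]; simp; omega

/-- The quotient brick's routine: `divPrep`; if the divisor is zero the answer is `0`
(`k / 0 = 0`, `x` is already empty), otherwise long division (`divOf`), discard the remainder,
move the quotient to `x`, normalise. [cite: CLRS2009, §31.1 (division theorem)] -/
def divC : Com (O ⊕ AReg) :=
  divPrep ;;
  Com.pop (Sum.inr .y)
    (Com.push (Sum.inr .y) true ;; (Com.divOf O.om O.oq ;; (Com.bk (Com.clear .x) ;;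
      (Com.move (Sum.inl O.oq) (Sum.inr .x) (Sum.inl O.od) ;; Com.bk Com.normalize))))
    (Com.push (Sum.inr .y) false ;; (Com.divOf O.om O.oq ;; (Com.bk (Com.clear .x) ;;
      (Com.move (Sum.inl O.oq) (Sum.inr .x) (Sum.inl O.od) ;; Com.bk Com.normalize))))
    Com.skip

/-- `divFn ⟨a, b⟩ = encodeNat (⟦a⟧ / ⟦b⟧)` (`/ 0 = 0`). [folklore] -/
def divFn (w : List Bool) : List Bool :=
  encodeNat (bitsToNat (boolUnpair w).1 / bitsToNat (boolUnpair w).2)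

/-- `divFn` on a pair. [folklore] -/
@[simp] theorem divFn_boolPair (a b : List Bool) : divFn (boolPair a b) = encodeNat (bitsToNat a / bitsToNat b) := by
  simp [divFn]

/-- Cost of the quotient brick in the total operand length. [folklore] -/
def quotCost (n : ℕ) : ℕ := 24 * n + 14 + (3 + (n * (41 * n + 48) + 1 + (17 * n + 8)))

/-- The main branch of the quotient brick on a positive divisor. [folklore] -/
theorem runs_divMain (a nb : List Bool) (hpos : 0 < bitsToNat nb) :
    Com.Runs (Com.divOf O.om O.oq ;; (Com.bk (Com.clear .x) ;;
        (Com.move (Sum.inl O.oq) (Sum.inr .x) (Sum.inl O.od) ;; Com.bk Com.normalize)) : Com (O ⊕ AReg))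
      (Sum.elim (Function.update (fun _ => []) O.om a.reverse) (file [] nb [] [] [] [] [] []))
      (Sum.elim (fun _ => []) (file (encodeNat (bitsToNat a / bitsToNat nb)) nb [] [] [] [] [] []))
      (a.length * (41 * nb.length + 48) + 1 + (17 * (a.length + nb.length) + 8)) := by
  set Q := Com.divBits a.reverse [] nb [] with hQ
  have hQl : Q.length = a.length := by rw [hQ, length_divBits']; simp
  have hQv : bitsToNat Q = bitsToNat a / bitsToNat nb := by
    rw [hQ, (Com.divOf_div_mod a.reverse nb hpos).1, List.reverse_reverse]
  -- long division
  have h1 := Com.runs_divOf (κ := O) (m := O.om) (q := O.oq) (by decide) a.reverse (Function.update (fun _ => []) O.om a.reverse)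
    [] nb [] (by simp) (by simpa using hpos) (by simp)
  rw [Function.update_idem, Function.update_eq_self_iff.2 rfl, List.length_reverse] at h1
  have hq0 : (Function.update (fun _ : O => ([] : List Bool)) O.om a.reverse) O.oq = [] := by simp
  rw [hq0, ← hQ] at h1
  obtain ⟨-, hrl⟩ := Com.remOfRes_lt_and_length a.reverse [] nb (by simpa using hpos) (by simp)
  set r := Com.remOfRes a.reverse [] nb with hr
  -- discard the remainder
  have h2 : Com.Runs (Com.bk (Com.clear .x) : Com (O ⊕ AReg)) (Sum.elim (Function.update (fun _ => []) O.oq Q) (file r nb [] [] [] [] [] []))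
      (Sum.elim (Function.update (fun _ => []) O.oq Q) (file [] nb [] [] [] [] [] [])) (2 * nb.length + 1) :=
    (((Com.runs_clear AReg.x (file r nb [] [] [] [] [] [])).of_eq (by simp) le_rfl).inr _).mono (by simp; omega)
  -- quotient to `x`
  have h3 : Com.Runs (Com.move (Sum.inl O.oq) (Sum.inr .x) (Sum.inl O.od) : Com (O ⊕ AReg))
      (Sum.elim (Function.update (fun _ => []) O.oq Q) (file [] nb [] [] [] [] [] []))
      (Sum.elim (fun _ => []) (file Q nb [] [] [] [] [] [])) (6 * a.length + 2) :=
    (Com.runs_move (a := (Sum.inl O.oq : O ⊕ AReg)) (b := Sum.inr AReg.x) (t := Sum.inl O.od) (by simp) (by simp) (by simp) _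
      (by simp)).of_eq (by simp [-Sum.elim_update_left, -Sum.elim_update_right, Function.update_idem]) (by simp [hQl])
  -- normalise
  have h4 : Com.Runs (Com.bk Com.normalize : Com (O ⊕ AReg)) (Sum.elim (fun _ => []) (file Q nb [] [] [] [] [] []))
      (Sum.elim (fun _ => []) (file (encodeNat (bitsToNat a / bitsToNat nb)) nb [] [] [] [] [] [])) (9 * a.length + 5) :=
    ((Com.runs_normalize Q nb [] [] [] []).inr _).of_eq (by rw [norm_eq_encodeNat, hQv]) (by rw [hQl])
  exact (h1.seq (h2.seq (h3.seq h4))).mono (by omega)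

/-- **`divFn ∈ FP`.** [cite: CLRS2009, §31.1 (division with remainder is polynomial)] -/
theorem divFn_mem_FP : divFn ∈ FP := by
  refine binOp_mem_FP divC (show (Sum.inr AReg.x : O ⊕ AReg) ≠ Sum.inr AReg.y by decide) (Sum.inr AReg.x)
    (fun a b => encodeNat (bitsToNat a / bitsToNat b)) quotCost
    (41 * Polynomial.X + 26 + Polynomial.X * (41 * Polynomial.X + 48))
    (fun n => le_of_eq ?_) (fun a b => ?_) (fun a b => ?_)
  · simp [quotCost]; ring
  · have h1 : (encodeNat (bitsToNat a / bitsToNat b)).length ≤ a.length :=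
      (length_encodeNat_mono (Nat.div_le_self _ _)).trans (length_encodeNat_bitsToNat_le a)
    refine h1.trans ?_
    simp; nlinarith [Nat.zero_le ((a.length + b.length) * (41 * (a.length + b.length) + 48))]
  · rw [init2_obank]
    have h0 := runs_divPrep a b
    have hnb := length_norm_le b
    set T1 : Regs O := Function.update (fun _ => []) O.om a.reverse with hT1
    rcases hn : norm b with _ | ⟨c, nb'⟩
    · -- divisor `0`: the answer is `0`, already on `x`
      rw [hn] at h0
      have hb0 : bitsToNat b = 0 := by simpa [hn] using (bitsToNat_norm b).symm
      have h12 := Com.Runs.pop_nil (k := (Sum.inr AReg.y : O ⊕ AReg)) (R := Sum.elim T1 (file [] [] [] [] [] [] [] []))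
        (Com.push (Sum.inr .y) true ;; (Com.divOf O.om O.oq ;; (Com.bk (Com.clear .x) ;;
          (Com.move (Sum.inl O.oq) (Sum.inr .x) (Sum.inl O.od) ;; Com.bk Com.normalize))))
        (Com.push (Sum.inr .y) false ;; (Com.divOf O.om O.oq ;; (Com.bk (Com.clear .x) ;;
          (Com.move (Sum.inl O.oq) (Sum.inr .x) (Sum.inl O.od) ;; Com.bk Com.normalize))))
        rfl (Com.Runs.skip _)
      refine ⟨_, (h0.seq h12).mono ?_, ?_⟩
      · unfold quotCost; nlinarith [Nat.zero_le ((a.length + b.length) * (41 * (a.length + b.length) + 48))]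
      · simp [hb0]; rfl
    · -- positive divisor
      rw [hn] at h0
      have hpos : 0 < bitsToNat (c :: nb') := by
        have h := (norm_eq_nil_iff b).not
        rw [hn] at h
        have : ¬ bitsToNat b = 0 := by simpa using h
        rw [← bitsToNat_norm b, hn] at this
        omega
      have hmain := runs_divMain a (c :: nb') hpos
      have hval : bitsToNat (c :: nb') = bitsToNat b := by rw [← hn, bitsToNat_norm]
      have hpush : ∀ d : Bool, Com.Runs (Com.push (Sum.inr .y) d : Com (O ⊕ AReg)) (Sum.elim T1 (file [] nb' [] [] [] [] [] []))
          (Sum.elim T1 (file [] (d :: nb') [] [] [] [] [] [])) 1 := fun d =>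
        Com.Runs.push' (by simp [-Sum.elim_update_left, -Sum.elim_update_right])
      have hbr : Com.Runs
          (Com.pop (Sum.inr .y)
            (Com.push (Sum.inr .y) true ;; (Com.divOf O.om O.oq ;; (Com.bk (Com.clear .x) ;;
              (Com.move (Sum.inl O.oq) (Sum.inr .x) (Sum.inl O.od) ;; Com.bk Com.normalize))))
            (Com.push (Sum.inr .y) false ;; (Com.divOf O.om O.oq ;; (Com.bk (Com.clear .x) ;;
              (Com.move (Sum.inl O.oq) (Sum.inr .x) (Sum.inl O.od) ;; Com.bk Com.normalize))))
            Com.skip : Com (O ⊕ AReg))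
          (Sum.elim T1 (file [] (c :: nb') [] [] [] [] [] []))
          (Sum.elim (fun _ => []) (file (encodeNat (bitsToNat a / bitsToNat (c :: nb'))) (c :: nb') [] [] [] [] [] []))
          (1 + (a.length * (41 * (c :: nb').length + 48) + 1 + (17 * (a.length + (c :: nb').length) + 8)) + 2) := by
        cases c
        · exact Com.Runs.pop_false (k := (Sum.inr AReg.y : O ⊕ AReg)) (R := Sum.elim T1 (file [] (false :: nb') [] [] [] [] [] []))
            _ _ (w := nb') rfl (by simpa [-Sum.elim_update_left, -Sum.elim_update_right] using (hpush false).seq hmain)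
        · exact Com.Runs.pop_true (k := (Sum.inr AReg.y : O ⊕ AReg)) (R := Sum.elim T1 (file [] (true :: nb') [] [] [] [] [] []))
            _ _ (w := nb') rfl (by simpa [-Sum.elim_update_left, -Sum.elim_update_right] using (hpush true).seq hmain)
      refine ⟨_, (h0.seq hbr).mono ?_, ?_⟩
      · have hl : (c :: nb').length ≤ b.length := by rw [← hn]; exact hnb
        unfold quotCost
        have : a.length * (41 * (c :: nb').length + 48) ≤ (a.length + b.length) * (41 * (a.length + b.length) + 48) :=
          Nat.mul_le_mul (by omega) (by omega)
        omega
      · simp [hval]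

/-! ### Modular exponentiation (three operands) -/

/-- Outer registers of the modular-exponentiation brick: the raw second operand, the scratch of
its pair decoder (`pA` then holds the exponent bits, most significant first), the reduced
base, the scratch of `modExp`, the dividend bits of the base reduction. [folklore] -/
inductive O3
  | pin | pA | pT | pM | pP | pxb | pm | pd
  deriving DecidableEq, Fintype, Repr

/-- The start file of the three-operand brick: first operand on the bank's `x`, the (still
paired) second operand on the outer `pin`. [folklore] -/
theorem init2_o3 (a b : List Bool) :
    init2 (Sum.inr AReg.x : O3 ⊕ AReg) (Sum.inl O3.pin) a b =
      Sum.elim (Function.update (fun _ => []) O3.pin b) (file a [] [] [] [] [] [] []) := by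
  funext i; rcases i with i | i
  · cases i <;> rfl
  · cases i <;> rfl

/-- The main branch of the modular-exponentiation brick: reduce the base modulo `n` (`remOf`
over `pd`), park it on `pxb`, start the accumulator at `1`, square-and-multiply over the
exponent bits on `pA` (`modExp`), normalise. [cite: CLRS2009, §31.6 (MODULAR-EXPONENTIATION)] -/
def modExpMain : Com (O3 ⊕ AReg) :=
  Com.pour (Sum.inr .x) (Sum.inl O3.pd) ;; (Com.remOf O3.pd ;; (Com.pour (Sum.inr .x) (Sum.inl O3.pP) ;;
    (Com.pour (Sum.inl O3.pP) (Sum.inl O3.pxb) ;; (Com.push (Sum.inr .x) true ;;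
    (Com.modExp O3.pA O3.pxb O3.pm ;; Com.bk Com.normalize)))))

/-- The guarded body: with the modulus `n` (normal) on `y`, answer `0` unless `n ≥ 2` (two pops,
restoring), else `modExpMain`. [folklore] -/
def modExpGuard : Com (O3 ⊕ AReg) :=
  Com.pop (Sum.inr .y)
    (Com.pop (Sum.inr .y) (Com.push (Sum.inr .y) true ;; (Com.push (Sum.inr .y) true ;; modExpMain))
      (Com.push (Sum.inr .y) false ;; (Com.push (Sum.inr .y) true ;; modExpMain)) (Com.bk (Com.clear .x)))
    (Com.pop (Sum.inr .y) (Com.push (Sum.inr .y) true ;; (Com.push (Sum.inr .y) false ;; modExpMain))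
      (Com.push (Sum.inr .y) false ;; (Com.push (Sum.inr .y) false ;; modExpMain)) (Com.bk (Com.clear .x)))
    (Com.bk (Com.clear .x))

/-- The modular-exponentiation brick's routine: split the second operand `⟨e, m⟩` (`unpairW`:
exponent bits reversed on `pA`, modulus reversed on `pT`), modulus to `y` and normalised
(through `x`), then the guarded body. [cite: CLRS2009, §31.6 (MODULAR-EXPONENTIATION)] -/
def modExpC : Com (O3 ⊕ AReg) :=
  Com.unpairW (Sum.inl O3.pin) (Sum.inl O3.pA) (Sum.inl O3.pT) (Sum.inl O3.pM) (Sum.inl O3.pP) ;;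
  (Com.pour (Sum.inl O3.pT) (Sum.inr .y) ;; (Com.bk (Com.swapXY ;; (Com.normalize ;; Com.swapXY)) ;; modExpGuard))

/-- The value of the modular-exponentiation brick on operands `a` and `b = ⟨e, m⟩`:
`⟦a⟧ ^ ⟦e⟧ mod ⟦m⟧` for `⟦m⟧ ≥ 2`, and `0` (the empty numeral) for `⟦m⟧ ≤ 1` — for `m = 1` this is
the true value, for `m = 0` a convention (Lean's `k % 0 = k` would make the output
exponentially long). [folklore] -/
def modExpVal (a b : List Bool) : List Bool :=
  if bitsToNat (boolUnpair b).2 ≤ 1 then []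
  else encodeNat (bitsToNat a ^ bitsToNat (boolUnpair b).1 % bitsToNat (boolUnpair b).2)

/-- `modExpFn ⟨a, ⟨e, m⟩⟩ = encodeNat (⟦a⟧ ^ ⟦e⟧ mod ⟦m⟧)` for `⟦m⟧ ≥ 2` (else `[]`). [folklore] -/
def modExpFn (w : List Bool) : List Bool := modExpVal (boolUnpair w).1 (boolUnpair w).2

/-- `modExpFn` on a triple with modulus `≥ 2`. [folklore] -/
theorem modExpFn_boolPair {m : List Bool} (hm : 2 ≤ bitsToNat m) (a e : List Bool) :
    modExpFn (boolPair a (boolPair e m)) = encodeNat (bitsToNat a ^ bitsToNat e % bitsToNat m) := by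
  simp [modExpFn, modExpVal, show ¬ bitsToNat m ≤ 1 by omega]

/-- `modExpFn` on a triple with modulus `≤ 1`. [folklore] -/
theorem modExpFn_boolPair_of_le {m : List Bool} (hm : bitsToNat m ≤ 1) (a e : List Bool) :
    modExpFn (boolPair a (boolPair e m)) = [] := by
  simp [modExpFn, modExpVal, hm]

/-- **Effect of `modExpMain`** on `x = a`, `y = n` with `⟦n⟧ ≥ 2`, exponent bits (reversed)
`eb` on `pA`, `pm pd pP pxb` empty: `x := encodeNat (⟦a⟧ ^ ⟦ebʳ⟧ mod ⟦n⟧)`. [cite: CLRS2009, §31.6 (MODULAR-EXPONENTIATION)] -/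
theorem runs_modExpMain (T : Regs O3) (a n eb : List Bool) (hn : 2 ≤ bitsToNat n) (hA : T O3.pA = eb)
    (hm : T O3.pm = []) (hd : T O3.pd = []) (hP : T O3.pP = []) (hxb : T O3.pxb = []) :
    ∃ zj xb : List Bool, Com.Runs modExpMain (Sum.elim T (file a n [] [] [] [] [] []))
      (Sum.elim (Function.update (Function.update T O3.pxb xb) O3.pA [])
        (file (encodeNat (bitsToNat a ^ bitsToNat eb.reverse % bitsToNat n)) n zj [] [] [] [] []))
      (3 * a.length + 1 + (a.length * (41 * n.length + 48) + 1 + (6 * n.length + 2 + (1 +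
        (eb.length * (Com.modExpStepCost n.length + 2) + 1 + (9 * n.length + 5)))))) := by
  have hpos : 0 < bitsToNat n := by omega
  have hne : ∀ {i j : O3}, i ≠ j → (Sum.inl i : O3 ⊕ AReg) ≠ Sum.inl j := fun h => by simpa using h
  -- base bits to `pd`
  set T1 := Function.update T O3.pd a.reverse with hT1
  have h1 : Com.Runs (Com.pour (Sum.inr .x) (Sum.inl O3.pd) : Com (O3 ⊕ AReg)) (Sum.elim T (file a n [] [] [] [] [] []))
      (Sum.elim T1 (file [] n [] [] [] [] [] [])) (3 * a.length + 1) :=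
    (Com.runs_pour (a := (Sum.inr AReg.x : O3 ⊕ AReg)) (b := Sum.inl O3.pd) (by simp) _).of_eq
      (by simp [-Sum.elim_update_left, -Sum.elim_update_right, hT1, hd]) (by simp)
  -- reduce the base
  have h2 := Com.runs_remOf (κ := O3) O3.pd a.reverse T1 [] n [] (by simp [hT1]) (by simpa using hpos) (by simp)
  have hT2 : Function.update T1 O3.pd [] = T := by
    rw [hT1, Function.update_idem]; exact Function.update_eq_self_iff.2 hd.symm
  rw [hT2, List.length_reverse] at h2
  obtain ⟨hxlt, hxl⟩ := Com.remOfRes_lt_and_length a.reverse [] n (by simpa using hpos) (by simp)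
  set xb := Com.remOfRes a.reverse [] n with hxbdef
  have hxv : bitsToNat xb = bitsToNat a % bitsToNat n := by
    rw [hxbdef, Com.bitsToNat_remOfRes_nil a.reverse n hpos, List.reverse_reverse]
  -- park it on `pxb`
  set T3 := Function.update T O3.pP xb.reverse with hT3
  have h3 : Com.Runs (Com.pour (Sum.inr .x) (Sum.inl O3.pP) : Com (O3 ⊕ AReg)) (Sum.elim T (file xb n [] [] [] [] [] []))
      (Sum.elim T3 (file [] n [] [] [] [] [] [])) (3 * xb.length + 1) :=
    (Com.runs_pour (a := (Sum.inr AReg.x : O3 ⊕ AReg)) (b := Sum.inl O3.pP) (by simp) _).of_eq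
      (by simp [-Sum.elim_update_left, -Sum.elim_update_right, hT3, hP]) (by simp)
  set T4 := Function.update T O3.pxb xb with hT4
  have h4 : Com.Runs (Com.pour (Sum.inl O3.pP) (Sum.inl O3.pxb) : Com (O3 ⊕ AReg)) (Sum.elim T3 (file [] n [] [] [] [] [] []))
      (Sum.elim T4 (file [] n [] [] [] [] [] [])) (3 * xb.length + 1) := by
    refine (Com.runs_pour (a := (Sum.inl O3.pP : O3 ⊕ AReg)) (b := Sum.inl O3.pxb) (by simp) _).of_eq ?_ (by simp [hT3])
    rw [hT3, hT4]
    funext i; rcases i with i | i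
    · by_cases h1 : i = O3.pxb
      · subst h1; simp [-Sum.elim_update_left, -Sum.elim_update_right, hxb]
      · by_cases h2 : i = O3.pP
        · subst h2; simp [-Sum.elim_update_left, -Sum.elim_update_right, hP]
        · simp [-Sum.elim_update_left, -Sum.elim_update_right, h1, h2]
    · simp [-Sum.elim_update_left, -Sum.elim_update_right]
  -- accumulator `1`
  have h5 : Com.Runs (Com.push (Sum.inr .x) true : Com (O3 ⊕ AReg)) (Sum.elim T4 (file [] n [] [] [] [] [] []))
      (Sum.elim T4 (file [true] n [] [] [] [] [] [])) 1 :=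
    Com.Runs.push' (by simp [-Sum.elim_update_left, -Sum.elim_update_right])
  -- square and multiply
  have h1lt : bitsToNat [true] < bitsToNat n := by simp; omega
  have hnl : 1 ≤ n.length := by
    rcases n with _ | ⟨c, n'⟩
    · simp at hn
    · simp
  obtain ⟨zj, -, h6⟩ := Com.runs_modExp (κ := O3) (e := O3.pA) (xb := O3.pxb) (m := O3.pm) (by decide) (by decide) (by decide)
    eb T4 [true] n [] (by simp [hT4, hA]) (by simp [hT4, hm]) h1lt (by simp [hT4, hxlt]) (by simpa using hnl) (by simp)
    (by simp [hT4, hxl])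
  have hT4x : T4 O3.pxb = xb := by simp [hT4]
  rw [hT4x] at h6
  obtain ⟨hrlt, hrl⟩ := Com.modExpRes_lt_and_length eb [true] n xb h1lt hxlt (by simpa using hnl)
  have hrv : bitsToNat (Com.modExpRes eb [true] n xb) = bitsToNat a ^ bitsToNat eb.reverse % bitsToNat n := by
    rw [Com.bitsToNat_modExpRes_one eb n xb (by omega) hxlt, hxv, ← Nat.pow_mod]
  -- normalise
  have h7 : Com.Runs (Com.bk Com.normalize : Com (O3 ⊕ AReg))
      (Sum.elim (Function.update T4 O3.pA []) (file (Com.modExpRes eb [true] n xb) n zj [] [] [] [] []))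
      (Sum.elim (Function.update T4 O3.pA []) (file (encodeNat (bitsToNat a ^ bitsToNat eb.reverse % bitsToNat n)) n zj [] [] [] [] []))
      (9 * n.length + 5) :=
    ((Com.runs_normalize (Com.modExpRes eb [true] n xb) n zj [] [] []).inr _).of_eq (by rw [norm_eq_encodeNat, hrv]) (by omega)
  refine ⟨zj, xb, (h1.seq (h2.seq (h3.seq (h4.seq (h5.seq (h6.seq h7)))))).of_eq (by rw [hT4]) ?_⟩
  omega

/-- Cost of the modular-exponentiation brick in the total operand length. [folklore] -/
def modExpCost (N : ℕ) : ℕ :=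
  64 * N + 40 + N * (41 * N + 48) + N * (Com.modExpStepCost N + 2)

/-- `modExpStepCost` is monotone. [folklore] -/
theorem modExpStepCost_mono {L L' : ℕ} (h : L ≤ L') : Com.modExpStepCost L ≤ Com.modExpStepCost L' := by
  unfold Com.modExpStepCost
  have := Nat.pow_le_pow_left h 2
  omega

/-- **`modExpFn ∈ FP`.** [cite: CLRS2009, §31.6 (MODULAR-EXPONENTIATION runs in polynomial time)] -/
theorem modExpFn_mem_FP : modExpFn ∈ FP := by
  refine binOp_mem_FP modExpC (show (Sum.inr AReg.x : O3 ⊕ AReg) ≠ Sum.inl O3.pin by simp) (Sum.inr AReg.x)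
    modExpVal modExpCost
    (64 * Polynomial.X + 40 + Polynomial.X * (41 * Polynomial.X + 48) +
      Polynomial.X * (382 * Polynomial.X ^ 2 + 262 * Polynomial.X + 15))
    (fun n => le_of_eq ?_) (fun a b => ?_) (fun a b => ?_)
  · simp [modExpCost, Com.modExpStepCost]
  · have h1 : (modExpVal a b).length ≤ b.length := by
      unfold modExpVal
      split_ifs with h
      · simp
      · have hm := length_boolUnpair_parts_le b
        have hlt := (Nat.mod_lt (bitsToNat a ^ bitsToNat (boolUnpair b).1) (show 0 < bitsToNat (boolUnpair b).2 by omega)).trans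
          (bitsToNat_lt _)
        have := Nat.size_le.2 hlt
        rw [TM2Pass.length_encodeNat_eq_size]; omega
    refine h1.trans ?_
    simp
    nlinarith [Nat.zero_le ((a.length + b.length) * (41 * (a.length + b.length) + 48)),
      Nat.zero_le ((a.length + b.length) * (382 * (a.length + b.length) ^ 2 + 262 * (a.length + b.length) + 15))]
  · rw [init2_o3]
    set e := (boolUnpair b).1 with he
    set m := (boolUnpair b).2 with hmdef
    have hem : 2 * e.length + m.length ≤ b.length := by rw [he, hmdef]; exact length_boolUnpair_parts_le b
    -- split the second operand
    have hd : [(Sum.inl O3.pin : O3 ⊕ AReg), Sum.inl O3.pA, Sum.inl O3.pT, Sum.inl O3.pM, Sum.inl O3.pP].Nodup := by simp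
    set T1 : Regs O3 := Function.update (Function.update (Function.update (fun _ => []) O3.pA e.reverse) O3.pT m.reverse)
      O3.pM (flag (wellPaired b)) with hT1
    have h1 : Com.Runs (Com.unpairW (Sum.inl O3.pin) (Sum.inl O3.pA) (Sum.inl O3.pT) (Sum.inl O3.pM) (Sum.inl O3.pP) : Com (O3 ⊕ AReg))
        (Sum.elim (Function.update (fun _ => []) O3.pin b) (file a [] [] [] [] [] [] []))
        (Sum.elim T1 (file a [] [] [] [] [] [] [])) (7 * b.length + 7) := by
      refine (Com.runs_unpairW hd _ (by simp) (by simp)).of_eq ?_ (by simp; omega)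
      rw [hT1]
      funext i; rcases i with i | i
      · cases i <;> simp [-Sum.elim_update_left, -Sum.elim_update_right, he, hmdef]
      · cases i <;> simp [-Sum.elim_update_left, -Sum.elim_update_right]
    -- modulus to `y`
    set T2 : Regs O3 := Function.update (Function.update (fun _ => []) O3.pA e.reverse) O3.pM (flag (wellPaired b)) with hT2
    have h2 : Com.Runs (Com.pour (Sum.inl O3.pT) (Sum.inr .y) : Com (O3 ⊕ AReg)) (Sum.elim T1 (file a [] [] [] [] [] [] []))
        (Sum.elim T2 (file a m [] [] [] [] [] [])) (3 * m.length + 1) := by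
      refine (Com.runs_pour (a := (Sum.inl O3.pT : O3 ⊕ AReg)) (b := Sum.inr AReg.y) (by simp) _).of_eq ?_ (by simp [hT1])
      rw [hT1, hT2]
      funext i; rcases i with i | i
      · cases i <;> simp [-Sum.elim_update_left, -Sum.elim_update_right]
      · cases i <;> simp [-Sum.elim_update_left, -Sum.elim_update_right]
    -- normalise it
    have hnm := length_norm_le m
    have h3 : Com.Runs (Com.bk (Com.swapXY ;; (Com.normalize ;; Com.swapXY)) : Com (O3 ⊕ AReg)) (Sum.elim T2 (file a m [] [] [] [] [] []))
        (Sum.elim T2 (file a (norm m) [] [] [] [] [] [])) (12 * a.length + 21 * m.length + 13) :=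
      (((Com.runs_swapXY a m [] [] [] []).seq ((Com.runs_normalize m a [] [] [] []).seq
        (Com.runs_swapXY (norm m) a [] [] [] []))).inr _).mono (by omega)
    -- facts about `T2`
    have hT2A : T2 O3.pA = e.reverse := by simp [hT2]
    have hT2m : T2 O3.pm = [] := by simp [hT2]
    have hT2d : T2 O3.pd = [] := by simp [hT2]
    have hT2P : T2 O3.pP = [] := by simp [hT2]
    have hT2xb : T2 O3.pxb = [] := by simp [hT2]
    -- the guard
    have hclear : ∀ (x' y' : List Bool), Com.Runs (Com.bk (Com.clear .x) : Com (O3 ⊕ AReg)) (Sum.elim T2 (file x' y' [] [] [] [] [] []))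
        (Sum.elim T2 (file [] y' [] [] [] [] [] [])) (2 * x'.length + 1) := fun x' y' =>
      ((Com.runs_clear AReg.x (file x' y' [] [] [] [] [] [])).of_eq (by simp) le_rfl).inr _
    have hpush : ∀ (c : Bool) (x' y' : List Bool), Com.Runs (Com.push (Sum.inr .y) c : Com (O3 ⊕ AReg))
        (Sum.elim T2 (file x' y' [] [] [] [] [] [])) (Sum.elim T2 (file x' (c :: y') [] [] [] [] [] [])) 1 := fun c x' y' =>
      Com.Runs.push' (by simp [-Sum.elim_update_left, -Sum.elim_update_right])
    have hval : bitsToNat (norm m) = bitsToNat m := bitsToNat_norm m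
    rcases hn : norm m with _ | ⟨c, _ | ⟨c', n''⟩⟩
    · -- modulus `0`
      have hm0 : bitsToNat m = 0 := by rw [← hval, hn]; rfl
      rw [hn] at h3
      have h4 := Com.Runs.pop_nil (k := (Sum.inr AReg.y : O3 ⊕ AReg)) (R := Sum.elim T2 (file a [] [] [] [] [] [] []))
        (Com.pop (Sum.inr .y) (Com.push (Sum.inr .y) true ;; (Com.push (Sum.inr .y) true ;; modExpMain))
          (Com.push (Sum.inr .y) false ;; (Com.push (Sum.inr .y) true ;; modExpMain)) (Com.bk (Com.clear .x)))
        (Com.pop (Sum.inr .y) (Com.push (Sum.inr .y) true ;; (Com.push (Sum.inr .y) false ;; modExpMain))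
          (Com.push (Sum.inr .y) false ;; (Com.push (Sum.inr .y) false ;; modExpMain)) (Com.bk (Com.clear .x)))
        rfl (hclear a [])
      refine ⟨_, (h1.seq (h2.seq (h3.seq h4))).mono ?_, ?_⟩
      · unfold modExpCost
        nlinarith [Nat.zero_le ((a.length + b.length) * (41 * (a.length + b.length) + 48)),
          Nat.zero_le ((a.length + b.length) * (Com.modExpStepCost (a.length + b.length) + 2))]
      · simp [modExpVal, ← hmdef, hm0]
    · -- modulus `1` (a one-digit canonical numeral)
      have hm1 : bitsToNat m ≤ 1 := by
        rw [← hval, hn]; cases c <;> simp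
      rw [hn] at h3
      have hin : Com.Runs (Com.pop (Sum.inr .y) (Com.push (Sum.inr .y) true ;; (Com.push (Sum.inr .y) c ;; modExpMain))
          (Com.push (Sum.inr .y) false ;; (Com.push (Sum.inr .y) c ;; modExpMain)) (Com.bk (Com.clear .x)) : Com (O3 ⊕ AReg))
          (Sum.elim T2 (file a [] [] [] [] [] [] [])) (Sum.elim T2 (file [] [] [] [] [] [] [] [])) (2 * a.length + 1 + 2) :=
        Com.Runs.pop_nil _ _ rfl (hclear a [])
      have h4 : Com.Runs modExpGuard (Sum.elim T2 (file a [c] [] [] [] [] [] [])) (Sum.elim T2 (file [] [] [] [] [] [] [] []))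
          (2 * a.length + 1 + 2 + 2) := by
        cases c
        · exact Com.Runs.pop_false (k := (Sum.inr AReg.y : O3 ⊕ AReg)) (R := Sum.elim T2 (file a [false] [] [] [] [] [] []))
            _ _ (w := []) rfl (by simpa [-Sum.elim_update_left, -Sum.elim_update_right] using hin)
        · exact Com.Runs.pop_true (k := (Sum.inr AReg.y : O3 ⊕ AReg)) (R := Sum.elim T2 (file a [true] [] [] [] [] [] []))
            _ _ (w := []) rfl (by simpa [-Sum.elim_update_left, -Sum.elim_update_right] using hin)
      refine ⟨_, (h1.seq (h2.seq (h3.seq h4))).mono ?_, ?_⟩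
      · unfold modExpCost
        nlinarith [Nat.zero_le ((a.length + b.length) * (41 * (a.length + b.length) + 48)),
          Nat.zero_le ((a.length + b.length) * (Com.modExpStepCost (a.length + b.length) + 2))]
      · simp [modExpVal, ← hmdef, hm1]
    · -- modulus `≥ 2`: the main branch
      set n := c :: c' :: n'' with hndef
      have hn2 : 2 ≤ bitsToNat n := by
        rw [two_le_bitsToNat_iff, ← hn, Com.norm_norm, hn, hndef]; simp
      have hmv : bitsToNat m = bitsToNat n := by rw [← hval, hn]
      have hnl : n.length ≤ m.length := by rw [← hn]; exact hnm
      rw [hn] at h3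
      obtain ⟨zj, xb, hmain⟩ := runs_modExpMain T2 a n e.reverse hn2 hT2A hT2m hT2d hT2P hT2xb
      rw [List.reverse_reverse, List.length_reverse] at hmain
      set K := 3 * a.length + 1 + (a.length * (41 * n.length + 48) + 1 + (6 * n.length + 2 + (1 +
        (e.length * (Com.modExpStepCost n.length + 2) + 1 + (9 * n.length + 5))))) with hK
      -- the two restoring pops in front of the main branch
      have hin : Com.Runs (Com.pop (Sum.inr .y) (Com.push (Sum.inr .y) true ;; (Com.push (Sum.inr .y) c ;; modExpMain))
          (Com.push (Sum.inr .y) false ;; (Com.push (Sum.inr .y) c ;; modExpMain)) (Com.bk (Com.clear .x)) : Com (O3 ⊕ AReg))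
          (Sum.elim T2 (file a (c' :: n'') [] [] [] [] [] []))
          (Sum.elim (Function.update (Function.update T2 O3.pxb xb) O3.pA [])
            (file (encodeNat (bitsToNat a ^ bitsToNat e % bitsToNat n)) n zj [] [] [] [] [])) (1 + (1 + K) + 2) := by
        cases c'
        · exact Com.Runs.pop_false (k := (Sum.inr AReg.y : O3 ⊕ AReg)) (R := Sum.elim T2 (file a (false :: n'') [] [] [] [] [] []))
            _ _ (w := n'') rfl (by simpa [-Sum.elim_update_left, -Sum.elim_update_right] using
              (hpush false a n'').seq ((hpush c a (false :: n'')).seq hmain))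
        · exact Com.Runs.pop_true (k := (Sum.inr AReg.y : O3 ⊕ AReg)) (R := Sum.elim T2 (file a (true :: n'') [] [] [] [] [] []))
            _ _ (w := n'') rfl (by simpa [-Sum.elim_update_left, -Sum.elim_update_right] using
              (hpush true a n'').seq ((hpush c a (true :: n'')).seq hmain))
      have h4 : Com.Runs modExpGuard (Sum.elim T2 (file a n [] [] [] [] [] []))
          (Sum.elim (Function.update (Function.update T2 O3.pxb xb) O3.pA [])
            (file (encodeNat (bitsToNat a ^ bitsToNat e % bitsToNat n)) n zj [] [] [] [] [])) (1 + (1 + K) + 2 + 2) := by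
        have hw : Function.update (Sum.elim T2 (file a n [] [] [] [] [] [])) (Sum.inr AReg.y : O3 ⊕ AReg) (c' :: n'') =
            Sum.elim T2 (file a (c' :: n'') [] [] [] [] [] []) := by
          simp [-Sum.elim_update_left, -Sum.elim_update_right]
        cases c
        · exact Com.Runs.pop_false (k := (Sum.inr AReg.y : O3 ⊕ AReg)) (R := Sum.elim T2 (file a n [] [] [] [] [] []))
            _ _ (w := c' :: n'') (by simp [hndef]) (by rw [hw]; exact hin)
        · exact Com.Runs.pop_true (k := (Sum.inr AReg.y : O3 ⊕ AReg)) (R := Sum.elim T2 (file a n [] [] [] [] [] []))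
            _ _ (w := c' :: n'') (by simp [hndef]) (by rw [hw]; exact hin)
      refine ⟨_, (h1.seq (h2.seq (h3.seq h4))).mono ?_, ?_⟩
      · unfold modExpCost
        have hsc := modExpStepCost_mono (show n.length ≤ a.length + b.length by omega)
        have hx1 : a.length * (41 * n.length + 48) ≤ (a.length + b.length) * (41 * (a.length + b.length) + 48) :=
          Nat.mul_le_mul (by omega) (by omega)
        have hx2 : e.length * (Com.modExpStepCost n.length + 2) ≤ (a.length + b.length) * (Com.modExpStepCost (a.length + b.length) + 2) :=
          Nat.mul_le_mul (by omega) (by omega)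
        omega
      · simp [modExpVal, ← hmdef, ← he, hmv, show ¬ bitsToNat n ≤ 1 by omega]

end Brick

end Literature.Computability.Complexity
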